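import Summits.QuantumFields.BalabanUV.Beta.GAN24.LayerPushGaugeTable

/-!
# `BalabanUV.Beta.GAN24.LayerPushGaugeTableCell` — binder row G-an2-4 / (CONV-C), W-slot CT-W, route «WC-TL» ∕ «QR-LL», row **(LT-Δ) «LAYER TRANSPORT»**, part (LT-3b) = (b3),
# file 2 of 2 of the OWNER gan24-p1 g26's HANDS (i) (RULING R-gan24p1-g26-2, journal l.40589): THE GAUGE-TABLE CELL THROUGH COARSE ENVELOPES — the count letter by letter
# (file 1 = `GAN24/LayerPushGaugeTable`: the slot-Ward binder, the identity, the Wilson docking instance, the column lemmas)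

NOT IN PRINT; OUR BOOKKEEPING ([folklore] file 1 column by column ⨾ `LayerPushFrozenSlice.leg_rel_sup ∕ leg_rel_lip` ⨾ `LayerPushEntry.exp_three_le` ⨾ the weighted block count;
G-an2-4 formalisation swarm, leaf prover `b2b-balaban-gan24-formalise-leaf-01`, gen 64).  HONEST FRAMING (cell contract, verbatim): «discharging `BetaPertH` makes Bałaban's UV
stability UNCONDITIONAL — a real constructive-QFT result; it is NOT the continuum limit and NOT the Clay problem.»  HONEST DEPENDENCY (verbatim): «continuum YM on T⁴ ⇐ BetaPertH ∧
nine spine estimates (0/9 proved); BetaPertH ⇐ (D1) ∧ (D4) ∧ CAP+tail; G-an2-4 gates asym, D1 and NE2/3/4.»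

## What (generic `d`, relative blocking `N ≥ 1`, GENERIC legs ∕ letters; kernel legs `Cl, Cr` (+ unit gradient `Cl′`), gauge table leg `|dz λ_{νU} κ u| ≤ Cg·e^{−κ‖quo N u − U‖₁}`
## (+ unit differences `Cg′`), companion `|S₀ x z κ₁ κ₂| ≤ C₀·ω₀ z·e^{−m‖x−z‖₁}` with a weight `0 ≤ ω₀ ≤ Ω` on the COLUMN site, `0 < κ`, `2κ < m`)
§3 `lam_step_rel`; **`abs_push₃_gaugeTable_le_weighted`** (BASE COUNT, no moment hypothesis):
   `|push₃ l r (dz λ) S ν U x′ z′ (inl α)(inl β)| ≤ (d+1)²·Cl·Cr·Cg·C₀·(2∕(m−2κ))·Zl((m−2κ)∕2)·e^{−(κ∕4)(‖x′−U‖₁+‖z′−U‖₁)}·Σ'_z ω₀ z·e^{−(κ∕2)‖quo N z − U‖₁}`;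
   **`abs_push₃_gaugeTable_sub_dipole_le_weighted`**: `|push₃ − DIPOLE| ≤ (d+1)³·Cr·C₀·(Cl′·Cg + Cl·Cg′)·(8∕(m−2κ)²)·Zl((m−2κ)∕4)·(same)`,
   `DIPOLE := Σ'_z Σ_{κ₂} (−Σ_{κ₁}Σ_i l α x′ κ₁ z·dz λ_{νU} i z·Π_i(z;κ₁κ₂))·r β z′ κ₂ z`, `Π_i(z;κ₁κ₂) := Σ'_x (x−z)_i·S₀ x z κ₁ κ₂` the companion's column DIPOLE MOMENTS, DISPLAYED;
   **`abs_push₃_gaugeTable_le_of_dipoleFree`** (`Π ≡ 0`).  NO charge hypothesis anywhere: the commutator kills constants.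
§4 THE LEDGER LINES (exponent arithmetic, legs GIVEN BY ENVELOPES of (N1)∕(N1′) size INCLUDING the gauge table leg): `ledger_pow_base` (`L^{3(d+1)}·(L^{d+2})⁻³·L^d = L^d·(L^3)⁻¹`,
   net `d − 3`; `ledger_base_three`: `= 1`, MARGINAL at `d = 3`), `ledger_pow_dipoleFree` (`… = 2·L^d·(L^4)⁻¹`, net `d − 4`; `ledger_dipoleFree_three`: `= 2·L⁻¹`).
READING (displayed, not claimed beyond the theorems): the table-slot gauge cell is marginal by absolute counting and gains its `−1` EXACTLY from a DIPOLE-FREE companion + an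
(N1′)-sized unit difference of the gauge table leg; with the SEAM-sized dressed gauge leg of journal R-leaf01-g63-5 (`Cg ~ Cg′ ~ L^{−(d+1)}` on the coarse block faces) both lines
read `L^{d−2}` — the located K-LL-4 question (the OWNER's E17), NOT resolved here; the slot-consumed form does not see the pure cell's per-slot zero-charge gain (the slot sum is
performed before the legs are frozen).
[folklore]; 0 cited facts, 0 `def`, 0 `def … : Prop`, 0 sorry.  Asserts NOTHING about which σ-letters satisfy the binder or have dipole-free companions (HANDS (ii)); NOTHING of
(Q-R)∕(LT)∕(Q-L)∕(C)∕«T2Shape»∕«T2Drift»∕(hW, hWall) discharged; NEVER «G-an2-4 closed» as (CONV-C); NOT D1, NOT `BetaPertH`, NOT continuum, NOT Clay.  2026-08-22.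
-/

noncomputable section

open Finset
open scoped BigOperators
open Literature.MathematicalPhysics.QuantumFieldTheory
open Literature.MathematicalPhysics.QuantumFieldTheory.Balaban1983to89
open Literature.MathematicalPhysics.QuantumFieldTheory.Balaban1983to89.Beta
open B12Sec2to5 (l1 l1_nonneg)
open ExpKernelCalculus (MKer Zl Zl_nonneg Zl_pos summable_exp_shift' tsum_exp_shift' l1_sub_triangle l1_sub_symm)
open OneStepResolventKernel (Fib)
open LatticeForm (quo)
open AffineAveraging (dz curv curvAdj)
open KKTFluctuationKernel (delta1)
open StepJetData (wilsonA)
open Summit.QuantumFields.BalabanUV.Beta.ChartConjugation (conjV)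
open Summit.QuantumFields.BalabanUV.Beta.BorderedHessian (diagK conjV_diagK_apply)
open Summit.QuantumFields.BalabanUV.Beta.GAN24.Push4 (vertexW vertexW_apply)
open Summit.QuantumFields.BalabanUV.Beta.GAN24.Push3 (push₃ push₃_inl_inl)
open Summit.QuantumFields.BalabanUV.Beta.GAN24.Push4TwoRate (summable_leg)
open Summit.QuantumFields.BalabanUV.Beta.GAN24.LatticeFreeze (abs_sub_le_of_unit_steps mul_exp_neg_le)
open Summit.QuantumFields.BalabanUV.Beta.GAN24.LayerPushMoments (abs_sub_sub_lin_le_of_unit_steps sq_mul_exp_neg_le)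
open Summit.QuantumFields.BalabanUV.Beta.GAN24.LayerPushEntry (abs_tsum_le_tsum_of_abs_le exp_three_le)
open Summit.QuantumFields.BalabanUV.Beta.GAN24.LayerPushFrozenSlice (exp_wobble leg_rel_sup leg_rel_lip)
open Summit.QuantumFields.BalabanUV.Beta.GAN24.ContactOneGaugeCellAlgebra (tsum_dz_mul_wilsonA_idx summable_mul_wilsonA_idx)
open Summit.QuantumFields.BalabanUV.Beta.GAN24.LayerPushGaugeTable (dz_eq_sub_single abs_cast_apply_le_l1 push₃_gaugeTable_inl_inl abs_col_le
  abs_col_sub_dipole_le abs_moment_le)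

namespace Summit.QuantumFields.BalabanUV.Beta.GAN24.LayerPushGaugeTableCell

variable {d : ℕ}

/-! ## §3 The gauge-table cell through coarse envelopes: the base count and the count minus the dipole term -/

section Cell

variable {l r : Fin (d + 1) → (Fin (d + 1) → ℤ) → Fin (d + 1) → (Fin (d + 1) → ℤ) → ℝ}
  {lam : Fin (d + 1) → (Fin (d + 1) → ℤ) → (Fin (d + 1) → ℤ) → ℝ}
  {S : Fin (d + 1) → (Fin (d + 1) → ℤ) → MKer (d + 1) (Fib d)} {S₀ : MKer (d + 1) (Fib d)} {ω₀ : (Fin (d + 1) → ℤ) → ℝ} {N : ℕ}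
  {Cl Cl' Cr Cg Cg' C₀ κ m Ω : ℝ}
  (hN : 1 ≤ N)
  (hWard : ∀ (ψ : (Fin (d + 1) → ℤ) → ℝ) (x z : Fin (d + 1) → ℤ) (κ₁ κ₂ : Fin (d + 1)),
    ∑ κ : Fin (d + 1), ∑' u : Fin (d + 1) → ℤ, dz ψ κ u * S κ u x z (Sum.inl κ₁) (Sum.inl κ₂)
      = S₀ x z (Sum.inl κ₁) (Sum.inl κ₂) * (ψ z - ψ x))
  (hl : ∀ α x' k x, |l α x' k x| ≤ Cl * Real.exp (-κ * l1 (quo N x - x')))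
  (hr : ∀ β z' k z, |r β z' k z| ≤ Cr * Real.exp (-κ * l1 (quo N z - z')))
  (hg : ∀ ν U k u, |dz (lam ν U) k u| ≤ Cg * Real.exp (-κ * l1 (quo N u - U)))
  (hS₀ : ∀ x z κ₁ κ₂, |S₀ x z (Sum.inl κ₁) (Sum.inl κ₂)| ≤ C₀ * ω₀ z * Real.exp (-m * l1 (x - z)))
  (hω : ∀ z, 0 ≤ ω₀ z ∧ ω₀ z ≤ Ω) (hκ : 0 < κ) (hm : 2 * κ < m) (hCl : 0 ≤ Cl) (hCr : 0 ≤ Cr) (hCg : 0 ≤ Cg) (hC₀ : 0 ≤ C₀)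

include hN hg hκ hCg in
/-- [folklore] The gauge function's unit steps seen from the column site `z`: `|λ_{νU}(p+e_i) − λ_{νU} p| ≤ (Cg·e^{−κ‖quo N z − U‖₁})·e^{κ‖p−z‖₁}` (block-label wobble). -/
theorem lam_step_rel (ν : Fin (d + 1)) (U z p : Fin (d + 1) → ℤ) (i : Fin (d + 1)) :
    |lam ν U (p + Pi.single i 1) - lam ν U p| ≤ Cg * Real.exp (-κ * l1 (quo N z - U)) * Real.exp (κ * l1 (p - z)) := by
  rw [← dz_eq_sub_single]
  calc |dz (lam ν U) i p| ≤ Cg * Real.exp (-κ * l1 (quo N p - U)) := hg ν U i p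
    _ ≤ Cg * (Real.exp (κ * l1 (p - z)) * Real.exp (-κ * l1 (quo N z - U))) := mul_le_mul_of_nonneg_left (exp_wobble hN hκ.le p z U) hCg
    _ = _ := by ring

include hN hWard hl hr hg hS₀ hω hκ hm hCl hCr hCg hC₀ in
/-- NOT IN PRINT; OUR BOOKKEEPING (§1 ⨾ §2 `abs_col_le` column by column with `pl = Cl·e^{−κ‖quo N z − x′‖₁}`, `g = Cg·e^{−κ‖quo N z − U‖₁}`, `B = C₀·ω₀ z` ⨾ the right leg AT the
column site ⨾ `LayerPushEntry.exp_three_le` ⨾ the weighted block count).  **THE GAUGE-TABLE CELL — BASE COUNT, NO MOMENT HYPOTHESIS**: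
`|push₃ l r (dz λ) S ν U x′ z′ (inl α) (inl β)| ≤ (d+1)²·Cl·Cr·Cg·C₀·(2∕(m−2κ))·Zl((m−2κ)∕2)·e^{−(κ∕4)(‖x′−U‖₁+‖z′−U‖₁)}·Σ'_z ω₀ z·e^{−(κ∕2)‖quo N z − U‖₁}` — the shape of
`LayerPushGaugeLeft.abs_push₃_gaugeLeft_le_weighted` with the companion's COLUMN weight `ω₀` in the place of the letter's slot weight: the table leg is consumed by the Ward
identity, its SUP `Cg` remains.  LEDGER (§4 `ledger_pow_base`): `L^{3(d+1)}·Cl·Cr·Cg·L^d` = `L^{d−3}` for three (N1)-sized legs — MARGINAL (`L^0`) at `d = 3`. -/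
theorem abs_push₃_gaugeTable_le_weighted (ν : Fin (d + 1)) (U x' z' : Fin (d + 1) → ℤ) (α β : Fin (d + 1)) :
    |push₃ l r (fun ν U κ u => dz (lam ν U) κ u) S ν U x' z' (Sum.inl α) (Sum.inl β)|
      ≤ (((d : ℝ) + 1) ^ 2 * Cl * Cr * Cg * C₀ * (2 / (m - 2 * κ) * Zl (d + 1) ((m - 2 * κ) / 2))) *
        Real.exp (-(κ / 4) * (l1 (x' - U) + l1 (z' - U))) *
          ∑' z : Fin (d + 1) → ℤ, ω₀ z * Real.exp (-(κ / 2) * l1 (quo N z - U)) := by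
  have hκ0 := hκ.le
  have hc : 0 < m - 2 * κ := sub_pos.2 hm
  have hZ1 : 0 ≤ Zl (d + 1) ((m - 2 * κ) / 2) := Zl_nonneg (half_pos hc)
  rw [push₃_gaugeTable_inl_inl hWard]
  -- per column
  have hcol : ∀ z κ₂, |∑' x : Fin (d + 1) → ℤ, ∑ κ₁ : Fin (d + 1), l α x' κ₁ x * (S₀ x z (Sum.inl κ₁) (Sum.inl κ₂) * (lam ν U z - lam ν U x))|
      ≤ ((d : ℝ) + 1) * (Cl * Real.exp (-κ * l1 (quo N z - x'))) * (C₀ * ω₀ z) * (Cg * Real.exp (-κ * l1 (quo N z - U)))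
          * (2 / (m - 2 * κ)) * Zl (d + 1) ((m - 2 * κ) / 2) := by
    intro z κ₂
    have hω0 := (hω z).1
    exact abs_col_le (lx := fun κ₁ x => l α x' κ₁ x) (K := S₀) (lam := lam ν U) (z := z) hm hκ0 (by positivity) (by positivity) (by positivity)
      (fun x κ₁ κ₂ => hS₀ x z κ₁ κ₂)
      (fun κ₁ x => leg_rel_sup hN hκ0 hCl (f := fun k x => l α x' k x) (fun k x => hl α x' k x) z κ₁ x)
      (fun p i => lam_step_rel hN hg hκ hCg ν U z p i) κ₂
  -- the column series against the weighted block count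
  have hg0 : ∀ z, 0 ≤ ω₀ z * Real.exp (-(κ / 2) * l1 (quo N z - U)) := fun z => by have := (hω z).1; positivity
  have hΩ : 0 ≤ Ω := (hω 0).1.trans (hω 0).2
  have hgs : Summable fun z => ω₀ z * Real.exp (-(κ / 2) * l1 (quo N z - U)) := by
    refine Summable.of_nonneg_of_le hg0 (fun z => ?_) ((summable_leg (d := d) hN (half_pos hκ) U).mul_left Ω)
    exact mul_le_mul_of_nonneg_right (hω z).2 (Real.exp_pos _).le
  have hτ : min (κ / 4) κ = κ / 4 := min_eq_left (by linarith)
  set A₁ : ℝ := ((d : ℝ) + 1) ^ 2 * Cl * Cr * Cg * C₀ * (2 / (m - 2 * κ) * Zl (d + 1) ((m - 2 * κ) / 2)) with hA₁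
  have hpt : ∀ z, |∑ κ₂ : Fin (d + 1), (∑' x : Fin (d + 1) → ℤ, ∑ κ₁ : Fin (d + 1),
      l α x' κ₁ x * (S₀ x z (Sum.inl κ₁) (Sum.inl κ₂) * (lam ν U z - lam ν U x))) * r β z' κ₂ z|
      ≤ (A₁ * Real.exp (-(κ / 4) * (l1 (x' - U) + l1 (z' - U)))) * (ω₀ z * Real.exp (-(κ / 2) * l1 (quo N z - U))) := by
    intro z
    have hω0 := (hω z).1
    have h3 := exp_three_le (d := d) hκ0 hκ0 (quo N z) U x' z'
    rw [hτ] at h3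
    calc _ ≤ ∑ κ₂ : Fin (d + 1), |(∑' x : Fin (d + 1) → ℤ, ∑ κ₁ : Fin (d + 1),
            l α x' κ₁ x * (S₀ x z (Sum.inl κ₁) (Sum.inl κ₂) * (lam ν U z - lam ν U x))) * r β z' κ₂ z| := Finset.abs_sum_le_sum_abs _ _
      _ ≤ ∑ _κ₂ : Fin (d + 1), (((d : ℝ) + 1) * (Cl * Real.exp (-κ * l1 (quo N z - x'))) * (C₀ * ω₀ z) * (Cg * Real.exp (-κ * l1 (quo N z - U)))
            * (2 / (m - 2 * κ)) * Zl (d + 1) ((m - 2 * κ) / 2)) * (Cr * Real.exp (-κ * l1 (quo N z - z'))) :=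
          Finset.sum_le_sum fun κ₂ _ => by
            rw [abs_mul]; exact mul_le_mul (hcol z κ₂) (hr β z' κ₂ z) (abs_nonneg _) (by positivity)
      _ = ((d : ℝ) + 1) ^ 2 * Cl * Cr * Cg * C₀ * (2 / (m - 2 * κ) * Zl (d + 1) ((m - 2 * κ) / 2)) * ω₀ z *
            (Real.exp (-κ * l1 (quo N z - U)) * Real.exp (-κ * l1 (quo N z - x')) * Real.exp (-κ * l1 (quo N z - z'))) := by
          rw [Finset.sum_const, Finset.card_univ, Fintype.card_fin, nsmul_eq_mul]; push_cast; ring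
      _ ≤ ((d : ℝ) + 1) ^ 2 * Cl * Cr * Cg * C₀ * (2 / (m - 2 * κ) * Zl (d + 1) ((m - 2 * κ) / 2)) * ω₀ z *
            (Real.exp (-(κ / 2) * l1 (quo N z - U)) * Real.exp (-(κ / 4) * (l1 (x' - U) + l1 (z' - U)))) :=
          mul_le_mul_of_nonneg_left h3 (by positivity)
      _ = _ := by rw [hA₁]; ring
  have h := abs_tsum_le_tsum_of_abs_le hpt (hgs.mul_left _)
  rw [tsum_mul_left] at h
  exact h

include hN hWard hl hr hg hS₀ hω hκ hm hCl hCr hCg hC₀ in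
/-- NOT IN PRINT; OUR BOOKKEEPING (§1 ⨾ §2 `abs_col_sub_dipole_le` column by column with `pl, ql = Cl, Cl′·e^{−κ‖quo N z − x′‖₁}`, `g, g′ = Cg, Cg′·e^{−κ‖quo N z − U‖₁}`,
`B = C₀·ω₀ z` ⨾ the right leg AT the column site ⨾ the weighted block count).  **THE GAUGE-TABLE CELL MINUS ITS DIPOLE TERM CARRIES ONE GRADIENT CONSTANT**: with, in addition,
coarse UNIT-GRADIENT envelopes `Cl′` of the left kernel leg ((N1′) shape) and `Cg′` of the gauge TABLE leg (its unit differences `|dz λ_{νU} κ (u+e_i) − dz λ_{νU} κ u|`),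
`|push₃ l r (dz λ) S ν U x′ z′ (inl α) (inl β) − DIPOLE| ≤ (d+1)³·Cr·C₀·(Cl′·Cg + Cl·Cg′)·(8∕(m−2κ)²)·Zl((m−2κ)∕4)·e^{−(κ∕4)(‖x′−U‖₁+‖z′−U‖₁)}·Σ'_z ω₀ z·e^{−(κ∕2)‖quo N z − U‖₁}`,
`DIPOLE := Σ'_z Σ_{κ₂} (−Σ_{κ₁} Σ_i l α x′ κ₁ z·dz λ_{νU} i z·Π_i(z; κ₁κ₂))·r β z′ κ₂ z`, `Π_i(z; κ₁κ₂) := Σ'_x (x−z)_i·S₀ x z κ₁ κ₂` DISPLAYED — legs and gauge table leg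
AT THE COLUMN SITE against the companion's column DIPOLE MOMENTS; NO charge hypothesis anywhere (the commutator kills constants).  LEDGER (§4 `ledger_pow_dipoleFree`):
`L^{3(d+1)}·Cr·(Cl′·Cg + Cl·Cg′)·L^d` = `L^{d−4}` for (N1)∕(N1′)-sized legs INCLUDING the gauge table leg — `L^{−1}` at `d = 3` once the dipole term is gone. -/
theorem abs_push₃_gaugeTable_sub_dipole_le_weighted (hCl' : 0 ≤ Cl') (hCg' : 0 ≤ Cg')
    (hl' : ∀ α x' k x i, |l α x' k (x + Pi.single i 1) - l α x' k x| ≤ Cl' * Real.exp (-κ * l1 (quo N x - x')))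
    (hg' : ∀ ν U k u i, |dz (lam ν U) k (u + Pi.single i 1) - dz (lam ν U) k u| ≤ Cg' * Real.exp (-κ * l1 (quo N u - U)))
    (ν : Fin (d + 1)) (U x' z' : Fin (d + 1) → ℤ) (α β : Fin (d + 1)) :
    |push₃ l r (fun ν U κ u => dz (lam ν U) κ u) S ν U x' z' (Sum.inl α) (Sum.inl β)
        - ∑' z : Fin (d + 1) → ℤ, ∑ κ₂ : Fin (d + 1),
            (-(∑ κ₁ : Fin (d + 1), ∑ i : Fin (d + 1), (l α x' κ₁ z * dz (lam ν U) i z) *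
                ∑' x : Fin (d + 1) → ℤ, (((x - z) i : ℤ) : ℝ) * S₀ x z (Sum.inl κ₁) (Sum.inl κ₂))) * r β z' κ₂ z|
      ≤ (((d : ℝ) + 1) ^ 3 * Cr * C₀ * (Cl' * Cg + Cl * Cg') * (8 / (m - 2 * κ) ^ 2 * Zl (d + 1) ((m - 2 * κ) / 4))) *
        Real.exp (-(κ / 4) * (l1 (x' - U) + l1 (z' - U))) *
          ∑' z : Fin (d + 1) → ℤ, ω₀ z * Real.exp (-(κ / 2) * l1 (quo N z - U)) := by
  have hκ0 := hκ.le
  have hc : 0 < m - 2 * κ := sub_pos.2 hm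
  have hm0 : 0 < m := by linarith
  have hZ2 : 0 ≤ Zl (d + 1) ((m - 2 * κ) / 4) := Zl_nonneg (by positivity : 0 < (m - 2 * κ) / 4)
  have hZ1 : 0 ≤ Zl (d + 1) ((m - 2 * κ) / 2) := Zl_nonneg (half_pos hc)
  have hZm : 0 ≤ Zl (d + 1) (m / 2) := Zl_nonneg (half_pos hm0)
  have hΩ : 0 ≤ Ω := (hω 0).1.trans (hω 0).2
  have he1 : ∀ (c : ℝ) (v : Fin (d + 1) → ℤ), 0 ≤ c → Real.exp (-c * l1 v) ≤ 1 := fun c v hc =>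
    Real.exp_le_one_iff.2 (by nlinarith [l1_nonneg v])
  rw [push₃_gaugeTable_inl_inl hWard]
  simp only [dz_eq_sub_single (lam ν U) _ _]
  -- envelopes at the column site
  set El : (Fin (d + 1) → ℤ) → ℝ := fun z => Real.exp (-κ * l1 (quo N z - x')) with hEl
  set Er : (Fin (d + 1) → ℤ) → ℝ := fun z => Real.exp (-κ * l1 (quo N z - z')) with hEr
  set EU : (Fin (d + 1) → ℤ) → ℝ := fun z => Real.exp (-κ * l1 (quo N z - U)) with hEU
  -- names for the column, the dipole piece
  obtain ⟨X, hX⟩ : ∃ X : (Fin (d + 1) → ℤ) → Fin (d + 1) → ℝ, X = fun z κ₂ =>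
      ∑' x : Fin (d + 1) → ℤ, ∑ κ₁ : Fin (d + 1), l α x' κ₁ x * (S₀ x z (Sum.inl κ₁) (Sum.inl κ₂) * (lam ν U z - lam ν U x)) := ⟨_, rfl⟩
  obtain ⟨P, hP⟩ : ∃ P : (Fin (d + 1) → ℤ) → Fin (d + 1) → ℝ, P = fun z κ₂ =>
      ∑ κ₁ : Fin (d + 1), ∑ i : Fin (d + 1), (l α x' κ₁ z * (lam ν U (z + Pi.single i 1) - lam ν U z)) *
        ∑' x : Fin (d + 1) → ℤ, (((x - z) i : ℤ) : ℝ) * S₀ x z (Sum.inl κ₁) (Sum.inl κ₂) := ⟨_, rfl⟩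
  -- per column: §2
  have hcolD : ∀ z κ₂, |X z κ₂ + P z κ₂| ≤ ((d : ℝ) + 1) ^ 2 * (C₀ * ω₀ z) * ((Cl' * El z) * (Cg * EU z) + (Cl * El z) * (Cg' * EU z))
      * (8 / (m - 2 * κ) ^ 2) * Zl (d + 1) ((m - 2 * κ) / 4) := by
    intro z κ₂
    have hω0 := (hω z).1
    rw [hX, hP]
    exact abs_col_sub_dipole_le (lx := fun κ₁ x => l α x' κ₁ x) (K := S₀) (lam := lam ν U) (z := z) hm hκ0 (by positivity) (by positivity)
      (by positivity) (by positivity) (by positivity)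
      (fun x κ₁ κ₂ => hS₀ x z κ₁ κ₂)
      (fun κ₁ x => leg_rel_sup hN hκ0 hCl (f := fun k x => l α x' k x) (fun k x => hl α x' k x) z κ₁ x)
      (fun κ₁ x => leg_rel_lip hN hκ0 hCl' (f := fun k x => l α x' k x) (fun k x i => hl' α x' k x i) z κ₁ x)
      (fun p i => lam_step_rel hN hg hκ hCg ν U z p i)
      (fun p i => by
        have h := abs_sub_le_of_unit_steps (f := fun q => lam ν U (q + Pi.single i 1) - lam ν U q) (u := z) (γ := Cg' * EU z) (κ := κ)
          (by positivity) hκ0 (fun q j => ?_) p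
        · exact h
        · have h1 := hg' ν U i q j
          rw [dz_eq_sub_single, dz_eq_sub_single] at h1
          calc _ ≤ Cg' * Real.exp (-κ * l1 (quo N q - U)) := h1
            _ ≤ Cg' * (Real.exp (κ * l1 (q - z)) * Real.exp (-κ * l1 (quo N z - U))) := mul_le_mul_of_nonneg_left (exp_wobble hN hκ0 q z U) hCg'
            _ = Cg' * EU z * Real.exp (κ * l1 (q - z)) := by ring)
      hm0 κ₂
  -- crude sizes (for summability of the two column series)
  have hXb : ∀ z κ₂, |X z κ₂| ≤ ((d : ℝ) + 1) * Cl * (C₀ * Ω) * Cg * (2 / (m - 2 * κ)) * Zl (d + 1) ((m - 2 * κ) / 2) := by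
    intro z κ₂
    have hω0 := (hω z).1
    rw [hX]
    have h := abs_col_le (lx := fun κ₁ x => l α x' κ₁ x) (K := S₀) (lam := lam ν U) (z := z) hm hκ0 (by positivity : 0 ≤ C₀ * ω₀ z)
      (by positivity : 0 ≤ Cl * El z) (by positivity : 0 ≤ Cg * EU z)
      (fun x κ₁ κ₂ => hS₀ x z κ₁ κ₂)
      (fun κ₁ x => leg_rel_sup hN hκ0 hCl (f := fun k x => l α x' k x) (fun k x => hl α x' k x) z κ₁ x)
      (fun p i => lam_step_rel hN hg hκ hCg ν U z p i) κ₂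
    refine h.trans ?_
    have hZ : 0 ≤ Zl (d + 1) ((m - 2 * κ) / 2) := Zl_nonneg (half_pos hc)
    have h1 : Cl * El z ≤ Cl := mul_le_of_le_one_right hCl (he1 κ _ hκ0)
    have h2 : C₀ * ω₀ z ≤ C₀ * Ω := mul_le_mul_of_nonneg_left (hω z).2 hC₀
    have h3 : Cg * EU z ≤ Cg := mul_le_of_le_one_right hCg (he1 κ _ hκ0)
    have := mul_le_mul (mul_le_mul (mul_le_mul_of_nonneg_left h1 (by positivity : (0:ℝ) ≤ (d : ℝ) + 1)) h2 (by positivity) (by positivity)) h3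
      (by positivity) (by positivity)
    exact mul_le_mul_of_nonneg_right (mul_le_mul_of_nonneg_right this (by positivity)) hZ
  have hPb : ∀ z κ₂, |P z κ₂| ≤ ((d : ℝ) + 1) * (((d : ℝ) + 1) * ((Cl * Cg) * ((C₀ * Ω) * (2 / m) * Zl (d + 1) (m / 2)))) := by
    intro z κ₂
    have hω0 := (hω z).1
    have hterm : ∀ κ₁ i, |(l α x' κ₁ z * (lam ν U (z + Pi.single i 1) - lam ν U z)) *
        ∑' x : Fin (d + 1) → ℤ, (((x - z) i : ℤ) : ℝ) * S₀ x z (Sum.inl κ₁) (Sum.inl κ₂)| ≤ (Cl * Cg) * ((C₀ * Ω) * (2 / m) * Zl (d + 1) (m / 2)) := by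
      intro κ₁ i
      rw [abs_mul, abs_mul]
      have h1 : |l α x' κ₁ z| ≤ Cl := (hl α x' κ₁ z).trans (mul_le_of_le_one_right hCl (he1 κ _ hκ0))
      have h2 : |lam ν U (z + Pi.single i 1) - lam ν U z| ≤ Cg := by
        rw [← dz_eq_sub_single]; exact (hg ν U i z).trans (mul_le_of_le_one_right hCg (he1 κ _ hκ0))
      have h3 := abs_moment_le (K := S₀) (z := z) (by positivity : 0 ≤ C₀ * ω₀ z) (fun x κ₁ κ₂ => hS₀ x z κ₁ κ₂) hm0 i κ₁ κ₂
      have h4 : C₀ * ω₀ z * (2 / m) * Zl (d + 1) (m / 2) ≤ C₀ * Ω * (2 / m) * Zl (d + 1) (m / 2) := by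
        have := mul_le_mul_of_nonneg_left (hω z).2 hC₀
        exact mul_le_mul_of_nonneg_right (mul_le_mul_of_nonneg_right this (by positivity)) hZm
      exact mul_le_mul (mul_le_mul h1 h2 (abs_nonneg _) hCl) (h3.trans h4) (abs_nonneg _) (by positivity)
    rw [hP]
    calc |∑ κ₁ : Fin (d + 1), ∑ i : Fin (d + 1), (l α x' κ₁ z * (lam ν U (z + Pi.single i 1) - lam ν U z)) *
          ∑' x : Fin (d + 1) → ℤ, (((x - z) i : ℤ) : ℝ) * S₀ x z (Sum.inl κ₁) (Sum.inl κ₂)|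
        ≤ ∑ κ₁ : Fin (d + 1), |∑ i : Fin (d + 1), (l α x' κ₁ z * (lam ν U (z + Pi.single i 1) - lam ν U z)) *
          ∑' x : Fin (d + 1) → ℤ, (((x - z) i : ℤ) : ℝ) * S₀ x z (Sum.inl κ₁) (Sum.inl κ₂)| := Finset.abs_sum_le_sum_abs _ _
      _ ≤ ∑ κ₁ : Fin (d + 1), ∑ i : Fin (d + 1), |(l α x' κ₁ z * (lam ν U (z + Pi.single i 1) - lam ν U z)) *
          ∑' x : Fin (d + 1) → ℤ, (((x - z) i : ℤ) : ℝ) * S₀ x z (Sum.inl κ₁) (Sum.inl κ₂)| :=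
          Finset.sum_le_sum fun κ₁ _ => Finset.abs_sum_le_sum_abs _ _
      _ ≤ ∑ _κ₁ : Fin (d + 1), ∑ _i : Fin (d + 1), (Cl * Cg) * ((C₀ * Ω) * (2 / m) * Zl (d + 1) (m / 2)) :=
          Finset.sum_le_sum fun κ₁ _ => Finset.sum_le_sum fun i _ => hterm κ₁ i
      _ = _ := by simp only [Finset.sum_const, Finset.card_univ, Fintype.card_fin, nsmul_eq_mul]; push_cast; ring
  have hXs : Summable fun z => ∑ κ₂ : Fin (d + 1), X z κ₂ * r β z' κ₂ z := by
    refine Summable.of_norm_bounded ((summable_leg (d := d) hN hκ z').mul_left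
      (((d : ℝ) + 1) * ((((d : ℝ) + 1) * Cl * (C₀ * Ω) * Cg * (2 / (m - 2 * κ)) * Zl (d + 1) ((m - 2 * κ) / 2)) * Cr))) fun z => ?_
    rw [Real.norm_eq_abs]
    calc |∑ κ₂ : Fin (d + 1), X z κ₂ * r β z' κ₂ z| ≤ ∑ κ₂ : Fin (d + 1), |X z κ₂ * r β z' κ₂ z| := Finset.abs_sum_le_sum_abs _ _
      _ ≤ ∑ _κ₂ : Fin (d + 1), ((((d : ℝ) + 1) * Cl * (C₀ * Ω) * Cg * (2 / (m - 2 * κ)) * Zl (d + 1) ((m - 2 * κ) / 2))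
            * (Cr * Real.exp (-κ * l1 (quo N z - z')))) :=
          Finset.sum_le_sum fun κ₂ _ => by
            rw [abs_mul]; exact mul_le_mul (hXb z κ₂) (hr β z' κ₂ z) (abs_nonneg _) (by positivity)
      _ = _ := by rw [Finset.sum_const, Finset.card_univ, Fintype.card_fin, nsmul_eq_mul]; push_cast; ring
  have hPs : Summable fun z => ∑ κ₂ : Fin (d + 1), (-P z κ₂) * r β z' κ₂ z := by
    refine Summable.of_norm_bounded ((summable_leg (d := d) hN hκ z').mul_left
      (((d : ℝ) + 1) * ((((d : ℝ) + 1) * (((d : ℝ) + 1) * ((Cl * Cg) * ((C₀ * Ω) * (2 / m) * Zl (d + 1) (m / 2))))) * Cr))) fun z => ?_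
    rw [Real.norm_eq_abs]
    calc |∑ κ₂ : Fin (d + 1), (-P z κ₂) * r β z' κ₂ z| ≤ ∑ κ₂ : Fin (d + 1), |(-P z κ₂) * r β z' κ₂ z| := Finset.abs_sum_le_sum_abs _ _
      _ ≤ ∑ _κ₂ : Fin (d + 1), ((((d : ℝ) + 1) * (((d : ℝ) + 1) * ((Cl * Cg) * ((C₀ * Ω) * (2 / m) * Zl (d + 1) (m / 2)))))
            * (Cr * Real.exp (-κ * l1 (quo N z - z')))) :=
          Finset.sum_le_sum fun κ₂ _ => by
            rw [abs_mul, abs_neg]; exact mul_le_mul (hPb z κ₂) (hr β z' κ₂ z) (abs_nonneg _) (by positivity)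
      _ = _ := by rw [Finset.sum_const, Finset.card_univ, Fintype.card_fin, nsmul_eq_mul]; push_cast; ring
  -- rewrite the goal in terms of `X`, `P`
  have eX : (∑' z : Fin (d + 1) → ℤ, ∑ κ₂ : Fin (d + 1), (∑' x : Fin (d + 1) → ℤ, ∑ κ₁ : Fin (d + 1),
      l α x' κ₁ x * (S₀ x z (Sum.inl κ₁) (Sum.inl κ₂) * (lam ν U z - lam ν U x))) * r β z' κ₂ z) = ∑' z, ∑ κ₂, X z κ₂ * r β z' κ₂ z := by rw [hX]
  have eP : (∑' z : Fin (d + 1) → ℤ, ∑ κ₂ : Fin (d + 1), (-(∑ κ₁ : Fin (d + 1), ∑ i : Fin (d + 1),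
      (l α x' κ₁ z * (lam ν U (z + Pi.single i 1) - lam ν U z)) *
        ∑' x : Fin (d + 1) → ℤ, (((x - z) i : ℤ) : ℝ) * S₀ x z (Sum.inl κ₁) (Sum.inl κ₂))) * r β z' κ₂ z)
      = ∑' z, ∑ κ₂, (-P z κ₂) * r β z' κ₂ z := by rw [hP]
  rw [eX, eP, ← hXs.tsum_sub hPs]
  have ept : ∀ z, (∑ κ₂ : Fin (d + 1), X z κ₂ * r β z' κ₂ z - ∑ κ₂ : Fin (d + 1), (-P z κ₂) * r β z' κ₂ z)
      = ∑ κ₂ : Fin (d + 1), (X z κ₂ + P z κ₂) * r β z' κ₂ z := by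
    intro z; rw [← Finset.sum_sub_distrib]; exact Finset.sum_congr rfl fun κ₂ _ => by ring
  rw [tsum_congr ept]
  -- the column series against the weighted block count
  have hg0 : ∀ z, 0 ≤ ω₀ z * Real.exp (-(κ / 2) * l1 (quo N z - U)) := fun z => by have := (hω z).1; positivity
  have hgs : Summable fun z => ω₀ z * Real.exp (-(κ / 2) * l1 (quo N z - U)) := by
    refine Summable.of_nonneg_of_le hg0 (fun z => ?_) ((summable_leg (d := d) hN (half_pos hκ) U).mul_left Ω)
    exact mul_le_mul_of_nonneg_right (hω z).2 (Real.exp_pos _).le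
  have hτ : min (κ / 4) κ = κ / 4 := min_eq_left (by linarith)
  set A₂ : ℝ := ((d : ℝ) + 1) ^ 3 * Cr * C₀ * (Cl' * Cg + Cl * Cg') * (8 / (m - 2 * κ) ^ 2 * Zl (d + 1) ((m - 2 * κ) / 4)) with hA₂
  have hpt : ∀ z, |∑ κ₂ : Fin (d + 1), (X z κ₂ + P z κ₂) * r β z' κ₂ z|
      ≤ (A₂ * Real.exp (-(κ / 4) * (l1 (x' - U) + l1 (z' - U)))) * (ω₀ z * Real.exp (-(κ / 2) * l1 (quo N z - U))) := by
    intro z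
    have hω0 := (hω z).1
    have h3 := exp_three_le (d := d) hκ0 hκ0 (quo N z) U x' z'
    rw [hτ] at h3
    calc _ ≤ ∑ κ₂ : Fin (d + 1), |(X z κ₂ + P z κ₂) * r β z' κ₂ z| := Finset.abs_sum_le_sum_abs _ _
      _ ≤ ∑ _κ₂ : Fin (d + 1), (((d : ℝ) + 1) ^ 2 * (C₀ * ω₀ z) * ((Cl' * El z) * (Cg * EU z) + (Cl * El z) * (Cg' * EU z))
            * (8 / (m - 2 * κ) ^ 2) * Zl (d + 1) ((m - 2 * κ) / 4)) * (Cr * Er z) :=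
          Finset.sum_le_sum fun κ₂ _ => by
            rw [abs_mul]; exact mul_le_mul (hcolD z κ₂) (hr β z' κ₂ z) (abs_nonneg _) (by positivity)
      _ = ((d : ℝ) + 1) ^ 3 * Cr * C₀ * (Cl' * Cg + Cl * Cg') * (8 / (m - 2 * κ) ^ 2 * Zl (d + 1) ((m - 2 * κ) / 4)) * ω₀ z *
            (EU z * El z * Er z) := by
          rw [Finset.sum_const, Finset.card_univ, Fintype.card_fin, nsmul_eq_mul]; push_cast; ring
      _ ≤ ((d : ℝ) + 1) ^ 3 * Cr * C₀ * (Cl' * Cg + Cl * Cg') * (8 / (m - 2 * κ) ^ 2 * Zl (d + 1) ((m - 2 * κ) / 4)) * ω₀ z *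
            (Real.exp (-(κ / 2) * l1 (quo N z - U)) * Real.exp (-(κ / 4) * (l1 (x' - U) + l1 (z' - U)))) :=
          mul_le_mul_of_nonneg_left h3 (by positivity)
      _ = _ := by rw [hA₂]; ring
  have h := abs_tsum_le_tsum_of_abs_le hpt (hgs.mul_left _)
  rw [tsum_mul_left] at h
  exact h

include hN hWard hl hr hg hS₀ hω hκ hm hCl hCr hCg hC₀ in
/-- NOT IN PRINT; OUR BOOKKEEPING.  **DIPOLE-FREE COMPANION ⇒ THE GAUGE-TABLE CELL CARRIES ONE GRADIENT CONSTANT**: if every column dipole moment of the companion vanishes,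
`∀ z i κ₁ κ₂, Σ'_x (x−z)_i·S₀ x z κ₁ κ₂ = 0`, the cell itself obeys the bound of `abs_push₃_gaugeTable_sub_dipole_le_weighted` — the (LT-Δ) gain of the table-slot gauge
cell in generic currency (the −1 of §4 `ledger_dipoleFree_three` at `d = 3` for (N1)∕(N1′)-sized legs). -/
theorem abs_push₃_gaugeTable_le_of_dipoleFree (hCl' : 0 ≤ Cl') (hCg' : 0 ≤ Cg')
    (hl' : ∀ α x' k x i, |l α x' k (x + Pi.single i 1) - l α x' k x| ≤ Cl' * Real.exp (-κ * l1 (quo N x - x')))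
    (hg' : ∀ ν U k u i, |dz (lam ν U) k (u + Pi.single i 1) - dz (lam ν U) k u| ≤ Cg' * Real.exp (-κ * l1 (quo N u - U)))
    (hPi : ∀ (z : Fin (d + 1) → ℤ) (i κ₁ κ₂ : Fin (d + 1)), ∑' x : Fin (d + 1) → ℤ, (((x - z) i : ℤ) : ℝ) * S₀ x z (Sum.inl κ₁) (Sum.inl κ₂) = 0)
    (ν : Fin (d + 1)) (U x' z' : Fin (d + 1) → ℤ) (α β : Fin (d + 1)) :
    |push₃ l r (fun ν U κ u => dz (lam ν U) κ u) S ν U x' z' (Sum.inl α) (Sum.inl β)|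
      ≤ (((d : ℝ) + 1) ^ 3 * Cr * C₀ * (Cl' * Cg + Cl * Cg') * (8 / (m - 2 * κ) ^ 2 * Zl (d + 1) ((m - 2 * κ) / 4))) *
        Real.exp (-(κ / 4) * (l1 (x' - U) + l1 (z' - U))) *
          ∑' z : Fin (d + 1) → ℤ, ω₀ z * Real.exp (-(κ / 2) * l1 (quo N z - U)) := by
  have h := abs_push₃_gaugeTable_sub_dipole_le_weighted hN hWard hl hr hg hS₀ hω hκ hm hCl hCr hCg hC₀ hCl' hCg' hl' hg' ν U x' z' α β
  simp only [hPi, mul_zero, Finset.sum_const_zero, neg_zero, zero_mul, tsum_zero, sub_zero] at h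
  exact h

end Cell

/-! ## §4 The ledger lines (exponent arithmetic only) -/

/-- [folklore] **BASE LEDGER OF THE TABLE-SLOT GAUGE CELL**: cubic weight, three (N1)-sized legs (two kernel legs and the gauge table leg's sup), layer count:
`L^{3(d+1)}·(L^{d+2})⁻¹·(L^{d+2})⁻¹·(L^{d+2})⁻¹·L^d = L^d·(L^3)⁻¹` — net exponent `d − 3`. -/
theorem ledger_pow_base (L : ℝ) (hL : L ≠ 0) (d : ℕ) :
    L ^ (3 * (d + 1)) * (L ^ (d + 2))⁻¹ * (L ^ (d + 2))⁻¹ * (L ^ (d + 2))⁻¹ * L ^ d = L ^ d * (L ^ 3)⁻¹ := by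
  field_simp
  ring

/-- [folklore] At `d = 3` the base ledger is MARGINAL: `L^{12}·L^{−5}·L^{−5}·L^{−5}·L^{3} = 1`. -/
theorem ledger_base_three (L : ℝ) (hL : L ≠ 0) : L ^ 12 * (L ^ 5)⁻¹ * (L ^ 5)⁻¹ * (L ^ 5)⁻¹ * L ^ 3 = 1 := by
  field_simp

/-- [folklore] **DIPOLE-FREE LEDGER OF THE TABLE-SLOT GAUGE CELL**: one GRADIENT-sized factor `(L^{d+3})⁻¹` among the three legs (either the left kernel leg's or the gauge table
leg's unit difference): `L^{3(d+1)}·(L^{d+2})⁻¹·((L^{d+3})⁻¹·(L^{d+2})⁻¹ + (L^{d+2})⁻¹·(L^{d+3})⁻¹)·L^d = 2·(L^d·(L^4)⁻¹)` — net exponent `d − 4`, the pure cell's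
(`LayerTransportCount.ledger_pow`). -/
theorem ledger_pow_dipoleFree (L : ℝ) (hL : L ≠ 0) (d : ℕ) :
    L ^ (3 * (d + 1)) * (L ^ (d + 2))⁻¹ * ((L ^ (d + 3))⁻¹ * (L ^ (d + 2))⁻¹ + (L ^ (d + 2))⁻¹ * (L ^ (d + 3))⁻¹) * L ^ d
      = 2 * (L ^ d * (L ^ 4)⁻¹) := by
  field_simp
  ring

/-- [folklore] At `d = 3` the dipole-free ledger nets `L⁻¹`: `L^{12}·L^{−5}·(L^{−6}·L^{−5} + L^{−5}·L^{−6})·L^{3} = 2·L⁻¹`. -/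
theorem ledger_dipoleFree_three (L : ℝ) (hL : L ≠ 0) :
    L ^ 12 * (L ^ 5)⁻¹ * ((L ^ 6)⁻¹ * (L ^ 5)⁻¹ + (L ^ 5)⁻¹ * (L ^ 6)⁻¹) * L ^ 3 = 2 * L⁻¹ := by
  field_simp
  ring

end Summit.QuantumFields.BalabanUV.Beta.GAN24.LayerPushGaugeTableCell

end
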